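import Mathlib
import HarnessLib
import Summits.FinalStateConjecture.Statement

/-!
# Crux idea `compensator-not-boost` — first lemmas (crux-ideate round 2, ideator 4, crux stmt-FinalStateConjecture-13550)

Folder `Sketch.lean` of planner-cruxidea-stmt-FinalStateConjecture-13550-4-0 (2026-08-16).  EVIDENCE / IDEA SUPPORT ONLY —
not a skeleton, not a proposal.  Everything is stated over existing declarations of the sorry-free prelude
(`Literature/Geometry/Lorentzian/{AsymptoticFlatness, TameGenericity, FinalState, …}.lean`) and of
`Summits/FinalStateConjecture/FinalStateConjecture/Statement.lean`.

The card targets the RE-TYPED crux G′ (lead c5's `RetypeKitC5.HonestFixedRadiusSettlingT`: TAME genericity +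
`RaysStayInClosure`), which implies the filed crux G (`Theses.StarvedNecks.HonestFixedRadiusSettling`) verbatim.

* `PT X` — the pointwise property of G′ (text of RetypeKitC5, split at `∀ X`); `HonestFixedRadiusSettlingT` = G′ via `PT`;
  `honestFixedRadiusSettlingT_iff_retype : _ ↔ <RetypeKitC5 text verbatim> := Iff.rfl` certifies the split is textual.
* `cleanSize e D M' R N` — the Dafermos–Rodnianski-WEIGHTED `C^N × C^N` size of `(h − (1 + 2M'/r)δ, k)` on `{‖x‖ > R}`
  (same weights as `AFEnd.wDist`, `N` derivatives): the quantitative "clean beyond `R`" gauge of the card.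
* `CleanedKicksOn X` (T1, the NEW elliptic stub, "rest-frame CK-cleaning of local kicks"): every tame immersed injective
  admissible LOCAL kick `G` through an admissible `d` (members `= d` off one compact `K`) can be CLEANED, beyond radii
  `Λ' c ≥ Λ c` and within any tolerance schedule `η c > 0`, into a tame immersed injective admissible family `F`,
  `F 0 = d`, `F c = G c` off `e.far (Λ' c)`, `e.wDist (F c) (G c) ≤ η c`, whose members `c ≠ 0` are, beyond `2 Λ' c`,
  `η c`-close in weighted `C⁶ × C⁶` to a Schwarzschild end of mass `M'` and Christodoulou–Klainerman flat TO ALL ORDERS.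
  Mechanism (card): Corvino–Schoen / Mao–Oh–Tao gluing UP TO LINEAR OBSTRUCTIONS at scale `λ = Λ' c` onto
  `Schwarzschild(M') + O_∞(r^{-2+ε})` ends with FLOATING mass `M' → M` and a non-gauge annular MOMENTUM COMPENSATOR of
  weighted size `~ sup_{r>λ} r²|k|` absorbing the translation cokernel (the DR class is a rest-frame class, `P_ADM = 0`).
* `RobustCureOn X P` (T2, the dynamical core in its native TAME shape): every exceptional admissible `d` carries a tame
  immersed injective admissible local kick `G`, radii `Λ` and tolerances `η > 0` such that EVERY admissible datum which
  agrees with `G c`, `c ≠ 0`, off `e.far Λ''` for some `Λ'' ≥ Λ c`, is `η c`-close to `G c` in `wDist`, and is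
  `η c`-clean beyond `2Λ''` (weighted `C⁶`, CK-flat to all orders) satisfies `P`.
* `isTameChristodoulouGeneric_of_cleanedKicks` (T3, PROVED): `CleanedKicksOn X → RobustCureOn X P →
  IsTameChristodoulouGeneric (admissibleVacuumData X) P 1` — pure selection bookkeeping.
* `honestFixedRadiusSettlingT_of` (PROVED): `CleanedKicks → RobustCure → G′`;
  `crux_of` (PROVED): `CleanedKicks → RobustCure → G` with G's ledger signature VERBATIM as the conclusion.
* `RestFrameCKCleaning` — the non-parametric DENSITY form of T1 (the cheapest typed version of the elliptic claim).
-/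

open scoped Manifold ContDiff ENNReal
open Filter Topology Set

noncomputable section

namespace Summit.FinalStateConjecture.FinalStateConjecture.Cruxes.HonestFixedRadiusSettling.Ideator4

open Literature.Geometry.Lorentzian

set_option linter.dupNamespace false
set_option linter.style.longLine false

/-- `PT X D` — the pointwise property whose TAME Christodoulou-genericity G′ asserts (lead c5's restatement of
item stmt-FinalStateConjecture-13550).  Text = RetypeKitC5.lean `HonestFixedRadiusSettlingT`, split at `∀ (X : Type)`. -/
def PT (X : Type) [TopologicalSpace X] [ChartedSpace E3 X] [IsManifold (𝓡 3) ∞ X] [T2Space X] [SecondCountableTopology X] [ConnectedSpace X] :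
    InitialDataSet (𝓡 3) X → Prop :=
  open Literature.Geometry.Lorentzian in open scoped ContDiff ENNReal in let Hc := ( fun (𝓢 : Spacetime.{0} 4) (O : Set 𝓢.carrier) (k : ℕ) (d : FinalStateDecomposition 𝓢 O k) (R₀ : ℝ) => let B := d.background; let t := fun i ↦ (B i).time; let r := fun i ↦ (B i).radius; let Ψ := d.chart; (∀ i, Kerr.IsSubextremal (d.mass i) (d.spin i) ∧ 100 * d.mass i ≤ R₀ ∧ 0 < ((d.motion i).1 : E4 ≃L[ℝ] E4) (E4.basisVector 0) 0) ∧ (∀ i (ϱ τ₂ : ℝ), R₀ ≤ ϱ → d.τ₀ < τ₂ → Ψ i '' {x | d.τ₀ < t i x.1 ∧ t i x.1 < τ₂ ∧ r i x.1 < ϱ} ⊆ 𝓢.metric.causalPast 𝓢.timeOrientation (Ψ i '' (B i).truncTimeSlab ϱ τ₂)) ∧ (∀ i (τ' : ℝ) (ϱ : ℝ → ℝ), Continuous ϱ → d.τ₀ < τ' → let A := Ψ i '' {x | τ' ≤ t i x.1 ∧ r i x.1 ≤ ϱ (t i x.1)}; closure A ∩ O ⊆ A) ∧ (∀ y : d.flatDomain,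 d.τ₀ < y.1 0 → 𝓢.timeOrientation.IsFutureDirected (mfderiv 𝓘(ℝ, E4) (𝓡 4) d.flatChart y (E4.basisVector 0))) ); let Hf := ( fun (𝓢 : Spacetime.{0} 4) (O : Set 𝓢.carrier) (k : ℕ) (d : FinalStateDecomposition 𝓢 O k) (R₀ : ℝ) => let B := d.background; let t := fun i ↦ (B i).time; let r := fun i ↦ (B i).radius; let Φ := d.flatChart; (∀ τ₂ : ℝ, d.τ₀ < τ₂ → Φ '' {y | d.τ₀ < y.1 0 ∧ y.1 0 < τ₂} ⊆ 𝓢.metric.causalPast 𝓢.timeOrientation (Φ '' (Minkowski.backgroundOn d.flatDomain).timeSlab τ₂)) ∧ (∀ τ' : ℝ, d.τ₀ < τ' → closure (Φ '' {y | τ' ≤ y.1 0 ∧ ∀ i, d.excision i (y.1 0) + 1 ≤ r i y.1}) ⊆ Φ '' {y | τ' ≤ y.1 0}) ∧ (∀ i, ∃ T : ℝ, supCkENorm (Subtype.val '' {x : (B i).domain | T ≤ t i x.1 ∧ R₀ ≤ r i x.1 ∧ ∀ j, j ≠ i → r i x.1 ≤ r j x.1}) 0 (𝓢.deviationExtend (B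 i) (d.chart i)) ≤ ENNReal.ofReal (1 / (10 * ‖(((d.motion i).1 : E4 ≃L[ℝ] E4) : E4 →L[ℝ] E4)‖ ^ 2))) ); (fun D ↦ (∃ 𝒟 : VacuumCauchyDevelopment D, 𝒟.IsMaximal) ∧ ∀ 𝒟 : VacuumCauchyDevelopment D, 𝒟.IsMaximal → HasCompleteNullInfinity 𝒟.toCauchyDevelopment ∧ ∃ (O : Set 𝒟.carrier) (d : FinalStateDecomposition 𝒟.toSpacetime O 4) (R₀ : ℝ), O = exteriorOf 𝒟.toCauchyDevelopment d.charted ∧ RaysStayInClosure 𝒟.toCauchyDevelopment O ∧ Hc 𝒟.toSpacetime O 4 d R₀ ∧ Hf 𝒟.toSpacetime O 4 d R₀)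

/-- G′ — `HonestFixedRadiusSettlingT`, written through `PT`. -/
def HonestFixedRadiusSettlingT : Prop :=
  ∀ (X : Type) [TopologicalSpace X] [ChartedSpace E3 X] [IsManifold (𝓡 3) ∞ X] [T2Space X] [SecondCountableTopology X] [ConnectedSpace X],
    InitialDataSet.IsTameChristodoulouGeneric (admissibleVacuumData X) (PT X) 1

/-- The split through `PT` is textual: G′ here is RetypeKitC5's `HonestFixedRadiusSettlingT` verbatim. -/
theorem honestFixedRadiusSettlingT_iff_retype :
    HonestFixedRadiusSettlingT ↔
      open Literature.Geometry.Lorentzian in open scoped ContDiff ENNReal in let Hc := ( fun (𝓢 : Spacetime.{0} 4) (O : Set 𝓢.carrier) (k : ℕ) (d : FinalStateDecomposition 𝓢 O k) (R₀ : ℝ) => let B := d.background; let t := fun i ↦ (B i).time; let r := fun i ↦ (B i).radius; let Ψ := d.chart; (∀ i, Kerr.IsSubextremal (d.mass i) (d.spin i) ∧ 100 * d.mass i ≤ R₀ ∧ 0 < ((d.motion i).1 : E4 ≃L[ℝ] E4) (E4.basisVector 0) 0) ∧ (∀ i (ϱ τ₂ : ℝ), R₀ ≤ ϱ → d.τ₀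 < τ₂ → Ψ i '' {x | d.τ₀ < t i x.1 ∧ t i x.1 < τ₂ ∧ r i x.1 < ϱ} ⊆ 𝓢.metric.causalPast 𝓢.timeOrientation (Ψ i '' (B i).truncTimeSlab ϱ τ₂)) ∧ (∀ i (τ' : ℝ) (ϱ : ℝ → ℝ), Continuous ϱ → d.τ₀ < τ' → let A := Ψ i '' {x | τ' ≤ t i x.1 ∧ r i x.1 ≤ ϱ (t i x.1)}; closure A ∩ O ⊆ A) ∧ (∀ y : d.flatDomain, d.τ₀ < y.1 0 → 𝓢.timeOrientation.IsFutureDirected (mfderiv 𝓘(ℝ, E4) (𝓡 4) d.flatChart y (E4.basisVector 0))) ); let Hf := ( fun (𝓢 : Spacetime.{0} 4) (O : Set 𝓢.carrier) (k : ℕ) (d : FinalStateDecomposition 𝓢 O k) (R₀ : ℝ) => let B := d.background; let t := fun i ↦ (B i).time; let r := fun i ↦ (B i).radius; let Φ := d.flatChart; (∀ τ₂ : ℝ, d.τ₀ < τ₂ → Φ '' {y | d.τ₀ < y.1 0 ∧ y.1 0 < τ₂} ⊆ 𝓢.metric.causalPast 𝓢.timeOrientation (Φ '' (Minkowski.backgroundOn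 d.flatDomain).timeSlab τ₂)) ∧ (∀ τ' : ℝ, d.τ₀ < τ' → closure (Φ '' {y | τ' ≤ y.1 0 ∧ ∀ i, d.excision i (y.1 0) + 1 ≤ r i y.1}) ⊆ Φ '' {y | τ' ≤ y.1 0}) ∧ (∀ i, ∃ T : ℝ, supCkENorm (Subtype.val '' {x : (B i).domain | T ≤ t i x.1 ∧ R₀ ≤ r i x.1 ∧ ∀ j, j ≠ i → r i x.1 ≤ r j x.1}) 0 (𝓢.deviationExtend (B i) (d.chart i)) ≤ ENNReal.ofReal (1 / (10 * ‖(((d.motion i).1 : E4 ≃L[ℝ] E4) : E4 →L[ℝ] E4)‖ ^ 2))) ); ∀ (X : Type) [TopologicalSpace X] [ChartedSpace E3 X] [IsManifold (𝓡 3) ∞ X] [T2Space X] [SecondCountableTopology X] [ConnectedSpace X], InitialDataSet.IsTameChristodoulouGeneric (admissibleVacuumData X) (fun D ↦ (∃ 𝒟 : VacuumCauchyDevelopment D, 𝒟.IsMaximal) ∧ ∀ 𝒟 : VacuumCauchyDevelopment D, 𝒟.IsMaximal → HasCompleteNullInfinity 𝒟.toCauchyDevelopment ∧ ∃ (O : Set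 𝒟.carrier) (d : FinalStateDecomposition 𝒟.toSpacetime O 4) (R₀ : ℝ), O = exteriorOf 𝒟.toCauchyDevelopment d.charted ∧ RaysStayInClosure 𝒟.toCauchyDevelopment O ∧ Hc 𝒟.toSpacetime O 4 d R₀ ∧ Hf 𝒟.toSpacetime O 4 d R₀) 1 :=
  Iff.rfl

section Clean

variable {X : Type} [TopologicalSpace X] [ChartedSpace E3 X] [IsManifold (𝓡 3) ∞ X]

/-- **Weighted `C^N × C^N` size of the deviation from a Schwarzschild end of mass `M'` beyond radius `R`**
(Dafermos–Rodnianski weights `‖x‖^{1+m}` on `Dᵐ(h − (1 + 2M'/r)δ)`, `‖x‖^{2+m}` on `Dᵐ k`, as in `AFEnd.wDist`;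
valued in `ℝ≥0∞`).  `cleanSize e D M' R N ≤ η` is the card's "clean beyond `R` to order `N` with tolerance `η`". -/
def cleanSize (e : AFEnd X) (D : InitialDataSet (𝓡 3) X) (M' R : ℝ) (N : ℕ) : ℝ≥0∞ :=
  (⨆ (m : ℕ) (_ : m ≤ N) (x : E3) (_ : R < ‖x‖),
      ENNReal.ofReal (‖x‖ ^ (1 + m)) *
        ‖iteratedFDeriv ℝ m
          (fun y ↦ e.hCoeff D y - (1 + 2 * M' / ‖y‖) • (innerSL ℝ : E3 →L[ℝ] E3 →L[ℝ] ℝ)) x‖ₑ) +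
    ⨆ (m : ℕ) (_ : m ≤ N) (x : E3) (_ : R < ‖x‖),
      ENNReal.ofReal (‖x‖ ^ (2 + m)) * ‖iteratedFDeriv ℝ m (e.kCoeff D) x‖ₑ

/-- `IsClean e d' Λ'' η` — the admitted far modifications of the card: beyond `2Λ''`, `d'` is `η`-close in weighted
`C⁶ × C⁶` to a Schwarzschild end of some mass `M'` and Christodoulou–Klainerman strongly asymptotically flat to all
orders with that mass. -/
def IsClean (e : AFEnd X) (d' : InitialDataSet (𝓡 3) X) (Λ'' η : ℝ) : Prop :=
  ∃ M' : ℝ, cleanSize e d' M' (2 * Λ'') 6 ≤ ENNReal.ofReal η ∧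
    ∀ n : ℕ, e.IsStronglyAsymptoticallyFlatWith d' M' (3 / 2) (5 / 2) n n

/-- `IsLocalKick d e K G` — a tame (on `e`), immersed, injective admissible one-parameter family through `d` whose
members equal `d` pointwise off the compact set `K`. -/
def IsLocalKick (d : InitialDataSet (𝓡 3) X) (e : AFEnd X) (K : Set X)
    (G : EuclideanSpace ℝ (Fin 1) → InitialDataSet (𝓡 3) X) : Prop :=
  InitialDataSet.IsTameDataFamily e 1 G ∧ InitialDataSet.IsImmersedAtZero 1 G ∧
    Function.Injective G ∧ G 0 = d ∧ (∀ c, G c ∈ admissibleVacuumData X) ∧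
    ∀ c x, x ∉ K → (G c).h.inner x = d.h.inner x ∧ (G c).k x = d.k x

variable (X)

/-- **T1 `CleanedKicksOn X` — rest-frame CK-cleaning of local kicks (the NEW elliptic stub).**  For every admissible
`d`, end `e`, compact `K`, local kick `G`, radius schedule `Λ` and tolerance schedule `η > 0` there are radii
`Λ' ≥ Λ` and a tame immersed injective admissible family `F` through `d` such that for `c ≠ 0`: `F c = G c` off
`e.far (Λ' c)`, `e.wDist (F c) (G c) ≤ η c`, and `F c` is `η c`-clean beyond `2 Λ' c`. -/
def CleanedKicksOn : Prop :=
  ∀ d ∈ admissibleVacuumData X, ∀ (e : AFEnd X) (K : Set X), IsCompact K →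
    ∀ G : EuclideanSpace ℝ (Fin 1) → InitialDataSet (𝓡 3) X, IsLocalKick d e K G →
      ∀ Λ η : EuclideanSpace ℝ (Fin 1) → ℝ, (∀ c, c ≠ 0 → 0 < η c) →
        ∃ (Λ' : EuclideanSpace ℝ (Fin 1) → ℝ) (F : EuclideanSpace ℝ (Fin 1) → InitialDataSet (𝓡 3) X),
          (∀ c, Λ c ≤ Λ' c) ∧
          InitialDataSet.IsTameDataFamily e 1 F ∧ InitialDataSet.IsImmersedAtZero 1 F ∧
          Function.Injective F ∧ F 0 = d ∧ (∀ c, F c ∈ admissibleVacuumData X) ∧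
          ∀ c, c ≠ 0 →
            (∀ x, x ∉ e.far (Λ' c) → (F c).h.inner x = (G c).h.inner x ∧ (F c).k x = (G c).k x) ∧
            e.wDist (F c) (G c) ≤ ENNReal.ofReal (η c) ∧ IsClean e (F c) (Λ' c) (η c)

/-- **T2 `RobustCureOn X P` — robust local amplitude cure (the dynamical core, tame shape).**  Every admissible `d`
failing `P` carries an end `e`, a compact `K`, a local kick `G`, radii `Λ` and tolerances `η > 0` such that every
admissible datum agreeing with `G c`, `c ≠ 0`, off `e.far Λ''` for some `Λ'' ≥ Λ c`, `η c`-close to `G c` in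
`e.wDist`, and `η c`-clean beyond `2Λ''`, satisfies `P`. -/
def RobustCureOn (P : InitialDataSet (𝓡 3) X → Prop) : Prop :=
  ∀ d ∈ admissibleVacuumData X, ¬ P d →
    ∃ (e : AFEnd X) (K : Set X), IsCompact K ∧
      ∃ G : EuclideanSpace ℝ (Fin 1) → InitialDataSet (𝓡 3) X, IsLocalKick d e K G ∧
        ∃ Λ η : EuclideanSpace ℝ (Fin 1) → ℝ, (∀ c, c ≠ 0 → 0 < η c) ∧
          ∀ c, c ≠ 0 → ∀ Λ'' : ℝ, Λ c ≤ Λ'' → ∀ d' ∈ admissibleVacuumData X,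
            (∀ x, x ∉ e.far Λ'' → d'.h.inner x = (G c).h.inner x ∧ d'.k x = (G c).k x) →
            e.wDist d' (G c) ≤ ENNReal.ofReal (η c) → IsClean e d' Λ'' (η c) → P d'

variable {X}

/-- **T3 (selection, PROVED).**  Cleaned kicks + robust cure ⇒ tame Christodoulou genericity of `P` in the
admissible class: the witness through an exceptional `d` is the cleaning `F` (T1) of the kick `G` (T2) beyond T2's
own radii and within T2's own tolerances. -/
theorem isTameChristodoulouGeneric_of_cleanedKicks (P : InitialDataSet (𝓡 3) X → Prop)
    (hC : CleanedKicksOn X) (hR : RobustCureOn X P) :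
    InitialDataSet.IsTameChristodoulouGeneric (admissibleVacuumData X) P 1 := by
  intro d hd
  obtain ⟨e, K, hK, G, hG, Λ, η, hη, hcure⟩ := hR d hd.1 hd.2
  obtain ⟨Λ', F, hΛ', hFt, hFi, hFinj, hF0, hFmem, hF⟩ := hC d hd.1 e K hK G hG Λ η hη
  refine ⟨e, F, hFt, hFi, hF0, hFinj, hFmem, ?_⟩
  intro c hc hmem
  obtain ⟨hagree, hw, hclean⟩ := hF c hc
  exact hmem.2 (hcure c hc (Λ' c) (hΛ' c) (F c) (hFmem c) hagree hw hclean)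

end Clean

/-- T1 for every admissible `3`-manifold. -/
def CleanedKicks : Prop :=
  ∀ (X : Type) [TopologicalSpace X] [ChartedSpace E3 X] [IsManifold (𝓡 3) ∞ X] [T2Space X] [SecondCountableTopology X] [ConnectedSpace X], CleanedKicksOn X

/-- T2 for the property `PT` of G′, for every admissible `3`-manifold. -/
def RobustCure : Prop :=
  ∀ (X : Type) [TopologicalSpace X] [ChartedSpace E3 X] [IsManifold (𝓡 3) ∞ X] [T2Space X] [SecondCountableTopology X] [ConnectedSpace X], RobustCureOn X (PT X)

/-- **G′ from T1 ∧ T2 (PROVED).** -/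
theorem honestFixedRadiusSettlingT_of (hC : CleanedKicks) (hR : RobustCure) : HonestFixedRadiusSettlingT :=
  fun X _ _ _ _ _ _ ↦ isTameChristodoulouGeneric_of_cleanedKicks (PT X) (hC X) (hR X)

/-- **The filed crux G from T1 ∧ T2 (PROVED)** — conclusion = the ledger signature of item
stmt-FinalStateConjecture-13550 (`Theses.StarvedNecks.HonestFixedRadiusSettling`) VERBATIM (plain genericity, no
rays clause), via G′ (forget tameness, immersion and `RaysStayInClosure`; the step is lead c5's
`honestFixedRadiusSettling_of_T` verbatim). -/
theorem crux_of (hC : CleanedKicks) (hR : RobustCure) :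
    open Literature.Geometry.Lorentzian in open scoped ContDiff ENNReal in let Hc := ( fun (𝓢 : Spacetime.{0} 4) (O : Set 𝓢.carrier) (k : ℕ) (d : FinalStateDecomposition 𝓢 O k) (R₀ : ℝ) => let B := d.background; let t := fun i ↦ (B i).time; let r := fun i ↦ (B i).radius; let Ψ := d.chart; (∀ i, Kerr.IsSubextremal (d.mass i) (d.spin i) ∧ 100 * d.mass i ≤ R₀ ∧ 0 < ((d.motion i).1 : E4 ≃L[ℝ] E4) (E4.basisVector 0) 0) ∧ (∀ i (ϱ τ₂ : ℝ), R₀ ≤ ϱ → d.τ₀ < τ₂ → Ψ i '' {x | d.τ₀ < t i x.1 ∧ t i x.1 < τ₂ ∧ r i x.1 < ϱ} ⊆ 𝓢.metric.causalPast 𝓢.timeOrientation (Ψ i '' (B i).truncTimeSlab ϱ τ₂)) ∧ (∀ i (τ' : ℝ) (ϱ : ℝ → ℝ), Continuous ϱ → d.τ₀ < τ' → let A := Ψ i '' {x | τ' ≤ t i x.1 ∧ r i x.1 ≤ ϱ (t i x.1)}; closure A ∩ O ⊆ A) ∧ (∀ y : d.flatDomain, d.τ₀ < y.1 0 → 𝓢.timeOrientation.IsFutureDirected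 (mfderiv 𝓘(ℝ, E4) (𝓡 4) d.flatChart y (E4.basisVector 0))) ); let Hf := ( fun (𝓢 : Spacetime.{0} 4) (O : Set 𝓢.carrier) (k : ℕ) (d : FinalStateDecomposition 𝓢 O k) (R₀ : ℝ) => let B := d.background; let t := fun i ↦ (B i).time; let r := fun i ↦ (B i).radius; let Φ := d.flatChart; (∀ τ₂ : ℝ, d.τ₀ < τ₂ → Φ '' {y | d.τ₀ < y.1 0 ∧ y.1 0 < τ₂} ⊆ 𝓢.metric.causalPast 𝓢.timeOrientation (Φ '' (Minkowski.backgroundOn d.flatDomain).timeSlab τ₂)) ∧ (∀ τ' : ℝ, d.τ₀ < τ' → closure (Φ '' {y | τ' ≤ y.1 0 ∧ ∀ i, d.excision i (y.1 0) + 1 ≤ r i y.1}) ⊆ Φ '' {y | τ' ≤ y.1 0}) ∧ (∀ i, ∃ T : ℝ, supCkENorm (Subtype.val '' {x : (B i).domain | T ≤ t i x.1 ∧ R₀ ≤ r i x.1 ∧ ∀ j, j ≠ i → r i x.1 ≤ r j x.1}) 0 (𝓢.deviationExtend (B i) (d.chart i)) ≤ ENNReal.ofReal (1 / (10 * ‖(((d.motion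 i).1 : E4 ≃L[ℝ] E4) : E4 →L[ℝ] E4)‖ ^ 2))) ); ∀ (X : Type) [TopologicalSpace X] [ChartedSpace E3 X] [IsManifold (𝓡 3) ∞ X] [T2Space X] [SecondCountableTopology X] [ConnectedSpace X], InitialDataSet.IsChristodoulouGeneric (admissibleVacuumData X) (fun D ↦ (∃ 𝒟 : VacuumCauchyDevelopment D, 𝒟.IsMaximal) ∧ ∀ 𝒟 : VacuumCauchyDevelopment D, 𝒟.IsMaximal → HasCompleteNullInfinity 𝒟.toCauchyDevelopment ∧ ∃ (O : Set 𝒟.carrier) (d : FinalStateDecomposition 𝒟.toSpacetime O 4) (R₀ : ℝ), O = exteriorOf 𝒟.toCauchyDevelopment d.charted ∧ Hc 𝒟.toSpacetime O 4 d R₀ ∧ Hf 𝒟.toSpacetime O 4 d R₀) 1 := by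
  have h : HonestFixedRadiusSettlingT := honestFixedRadiusSettlingT_of hC hR
  intro Hc Hf X _ _ _ _ _ _
  have mono : ∀ (P Q : Literature.Geometry.Lorentzian.InitialDataSet (𝓡 3) X → Prop),
      (∀ D ∈ Literature.Geometry.Lorentzian.admissibleVacuumData X, P D → Q D) →
      Literature.Geometry.Lorentzian.InitialDataSet.IsChristodoulouGeneric
        (Literature.Geometry.Lorentzian.admissibleVacuumData X) P 1 →
      Literature.Geometry.Lorentzian.InitialDataSet.IsChristodoulouGeneric
        (Literature.Geometry.Lorentzian.admissibleVacuumData X) Q 1 := by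
    intro P Q hPQ hP d hd
    obtain ⟨F, hF, h0, hinj, hmem, hE⟩ := hP d ⟨hd.1, fun h ↦ hd.2 (hPQ d hd.1 h)⟩
    exact ⟨F, hF, h0, hinj, hmem, fun c hc hc' ↦ hE c hc ⟨hc'.1, fun h ↦ hc'.2 (hPQ _ hc'.1 h)⟩⟩
  refine mono _ _ ?_ (h X).isChristodoulouGeneric
  rintro D - ⟨hex, hall⟩
  refine ⟨hex, fun 𝒟 h𝒟 ↦ ?_⟩
  obtain ⟨hscri, O, dd, R₀, hO, -, hcore, hfar⟩ := hall 𝒟 h𝒟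
  exact ⟨hscri, O, dd, R₀, hO, hcore, hfar⟩

/-- **`RestFrameCKCleaning` — density form of T1 (the elliptic claim in its cheapest typed form, for refuters).**
Every admissible datum `d`, DR-flat with mass `M > 0` on a sole end `e`, agrees on any compact `K` with an admissible
`d'` with `e.wDist d' d ≤ η` which is `η`-clean beyond `2R` for some `R` (weighted `C⁶`-close to a Schwarzschild end
of mass `M'`, `|M' − M| ≤ η`, CK-flat to all orders).  (`M = 0` is the trivial datum by positive-mass rigidity.)
Printed neighbours glue onto BOOSTED Kerr ends to adjust `P` (Corvino–Schoen 2006; Chruściel–Delay 2003; Mao–Oh–Tao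
2023, Thm 1.6) or keep `(E, P)` only under Regge–Teitelboim parity (Huang–Schoen–Wang 2011, Thm 3); here
`P_ADM = 0` on both sides WITHOUT parity and the residual translation obstruction is absorbed by an annular
compensator of weighted size `O(sup_{r>R} r²|k|)`. -/
def RestFrameCKCleaning : Prop :=
  ∀ (X : Type) [TopologicalSpace X] [ChartedSpace E3 X] [IsManifold (𝓡 3) ∞ X] [T2Space X] [SecondCountableTopology X] [ConnectedSpace X],
    ∀ d ∈ admissibleVacuumData X, ∀ (e : AFEnd X) (M : ℝ), e.IsSoleEnd →
      e.IsStronglyAsymptoticallyFlatDR d M → 0 < M →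
      ∀ (K : Set X), IsCompact K → ∀ η : ℝ, 0 < η →
        ∃ (d' : InitialDataSet (𝓡 3) X) (M' R : ℝ), d' ∈ admissibleVacuumData X ∧
          (∀ x ∈ K, d'.h.inner x = d.h.inner x ∧ d'.k x = d.k x) ∧
          |M' - M| ≤ η ∧ e.wDist d' d ≤ ENNReal.ofReal η ∧
          cleanSize e d' M' (2 * R) 6 ≤ ENNReal.ofReal η ∧
          ∀ n : ℕ, e.IsStronglyAsymptoticallyFlatWith d' M' (3 / 2) (5 / 2) n n

end Summit.FinalStateConjecture.FinalStateConjecture.Cruxes.HonestFixedRadiusSettling.Ideator4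

end
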